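import Mathlib
import HarnessLib
import Summits.NavierStokesRegularity.NavierStokesRegularity.Theorems.PlaneStrainDoorZoomSpaceTimeDecay

/-!
# nsreg-p1 ROUND-18 door S19 «LocalTiltingFreeDoor» — the zoom crux K1 `LocalPointZoomTiltingFreeWindow` PROVED and
# the door `Target` PROVED MODULO the profile crux K2 `TiltingFreeProfileRigidity` (by name)

Door S19 (nsreg-p1 g16, `HOME/ns-regularity-ideate-p1/ROUND-18.md`, `r18/Sketch19.lean` 8826b4ea9dfcd4c1; DESIGN-ONLY,
route NOT born).  The door is the S16 `LocalProductionFreeDoor` format with the PRODUCTION density `⟪curl A, A curl A⟫`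
replaced by the norm of the VORTEX-TILTING vector `‖curl A × (A curl A)‖`, `A = (T−t)·∇u(t, x₀ + √(T−t)y)` the
scale-normalised velocity gradient: a classical Leray–Hopf flow from rapidly decaying data, locally SPACE–TIME Type I
at `(x₀,T)`, whose scale-normalised tilting fades in `L¹` over ONE nonempty open similarity window is backward bounded
at `x₀` — PROVIDED tilting-free Type-I ancient mild profiles are not backward-singular (K2, OPEN = Galanti–Gibbon–Heritage
1997 §6 Q1 made precise).

* `tilting_smul`, `continuous_tiltingNorm`, `tiltingNorm_zeroSetInvariant` — the tilting vector is CUBIC-homogeneous in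
  `A` (`curl (bA) × (bA (curl bA)) = b³ · curl A × (A curl A)`), jointly continuous, with dilation-invariant zero set;
* `localPointZoomTiltingFreeWindow` — **K1 `LocalPointZoomTiltingFreeWindow` (text verbatim), PROVED**: the tree's
  parabolic point zoom `localPointZoomVelGradSlices` + space–time decay of the profile `hasTypeIDecay_of_zoom` + the
  first-order window Fatou step `windowFatou_firstOrder_of_zeroSetInvariant` (the S16 `k1_proof`, integrand swapped);
* `target_of_tiltingFreeProfileRigidity` — **`Target` (text verbatim) from the text of K2 alone**, through the generic
  space–time door `spaceTimeDoor_of_profileWindowRigidity` with `F(A) = ‖curl A × (A curl A)‖` (so the planner's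
  `closes h₁ h₂` has `h₁` discharged: S19 = door modulo exactly K2).

Seat nsreg-p6 g10 (THEOREMS-ONLY door sequels, DIRECTOR-NS g8 #32 (2)/#36).  WHAT THIS IS NOT: not NS regularity
(Clay A) — a CONDITIONAL one-point, one-window regularity criterion under LOCAL SPACE–TIME Type I, itself conditional on
the OPEN profile crux K2; not K2; no route is opened.
-/

noncomputable section

-- the summit and its single sub-problem share the name (CONVENTIONS §1)
set_option linter.dupNamespace false

namespace Summit.NavierStokesRegularity.NavierStokesRegularity.Theorems.LocalTiltingFreeDoorTarget

open MeasureTheory Set Function Filter Topology Metric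
open scoped RealInnerProductSpace InnerProductSpace NNReal ENNReal
open Literature.Analysis Literature.Analysis.FluidPDE
open Summit.NavierStokesRegularity.NavierStokesRegularity.Theorems.LocalSineTubeDoorLocalPointZoomGradSlices
open Summit.NavierStokesRegularity.NavierStokesRegularity.Theorems.LocalSineTubeDoorWindowFatou
open Summit.NavierStokesRegularity.NavierStokesRegularity.Theorems.PlaneStrainDoorZoomSpaceTimeDecay

/-! ### The tilting vector of an operator: homogeneity, continuity, zero set -/

/-- Cubic homogeneity of the tilting vector: `curl (bA) × (bA (curl bA)) = b³ · (curl A × (A (curl A)))`. -/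
theorem tilting_smul (b : ℝ) (A : EuclideanSpace ℝ (Fin 3) →L[ℝ] EuclideanSpace ℝ (Fin 3)) :
    cross (curlCLM (b • A)) ((b • A) (curlCLM (b • A))) = b ^ 3 • cross (curlCLM A) (A (curlCLM A)) := by
  have hc : curlCLM (b • A) = b • curlCLM A := map_smul _ _ _
  have h1 : (b • A) (curlCLM (b • A)) = (b * b) • A (curlCLM A) := by
    rw [hc, mul_smul, show (b • A) (b • curlCLM A) = b • A (b • curlCLM A) from rfl, map_smul]
  have h2 : ∀ (x y : EuclideanSpace ℝ (Fin 3)) (r : ℝ), cross (r • x) y = r • cross x y := fun x y r => by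
    rw [← crossCLM_apply, ← crossCLM_apply, map_smul]; rfl
  have h3 : ∀ (x y : EuclideanSpace ℝ (Fin 3)) (r : ℝ), cross x (r • y) = r • cross x y := fun x y r => by
    rw [← crossCLM_apply, ← crossCLM_apply, map_smul]
  rw [h1, hc, h2, h3, smul_smul]
  congr 1
  ring

/-- Joint continuity of the tilting norm in `(y, A)` (it does not depend on `y`). -/
theorem continuous_tiltingNorm : Continuous fun q : EuclideanSpace ℝ (Fin 3) ×
    (EuclideanSpace ℝ (Fin 3) →L[ℝ] EuclideanSpace ℝ (Fin 3)) => ‖cross (curlCLM q.2) (q.2 (curlCLM q.2))‖ := by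
  have h1 : Continuous fun A : EuclideanSpace ℝ (Fin 3) →L[ℝ] EuclideanSpace ℝ (Fin 3) => curlCLM A :=
    curlCLM.continuous
  have h2 : Continuous fun A : EuclideanSpace ℝ (Fin 3) →L[ℝ] EuclideanSpace ℝ (Fin 3) => A (curlCLM A) :=
    isBoundedBilinearMap_apply.continuous.comp (continuous_id.prodMk h1)
  have h3 : Continuous fun A : EuclideanSpace ℝ (Fin 3) →L[ℝ] EuclideanSpace ℝ (Fin 3) =>
      crossCLM (curlCLM A) (A (curlCLM A)) :=
    crossCLM.continuous₂.comp (h1.prodMk h2)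
  exact (h3.norm).comp continuous_snd

/-- Dilation invariance of the zero set of the tilting norm. -/
theorem tiltingNorm_zeroSetInvariant (a b : ℝ) (_ha : 0 < a) (hb : 0 < b) (x : EuclideanSpace ℝ (Fin 3))
    (A : EuclideanSpace ℝ (Fin 3) →L[ℝ] EuclideanSpace ℝ (Fin 3)) :
    (fun (_ : EuclideanSpace ℝ (Fin 3)) (B : EuclideanSpace ℝ (Fin 3) →L[ℝ] EuclideanSpace ℝ (Fin 3)) =>
        ‖cross (curlCLM B) (B (curlCLM B))‖) (a • x) (b • A) = 0 ↔
      (fun (_ : EuclideanSpace ℝ (Fin 3)) (B : EuclideanSpace ℝ (Fin 3) →L[ℝ] EuclideanSpace ℝ (Fin 3)) =>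
        ‖cross (curlCLM B) (B (curlCLM B))‖) x A = 0 := by
  simp only [tilting_smul, norm_smul, norm_pow, Real.norm_eq_abs, mul_eq_zero, pow_eq_zero_iff (Nat.succ_ne_zero 2),
    abs_eq_zero, hb.ne', false_or]

/-! ### K1 -/

/-- **crux (rank 3) K1 `LocalPointZoomTiltingFreeWindow` (text of nsreg-p1 `r18/Sketch19.lean`, verbatim), PROVED.**
At a locally space–time Type-I point of a classical Leray–Hopf flow whose scale-normalised vortex tilting fades in `L¹`
on one nonempty open similarity window, if the point is NOT backward bounded the parabolic point zoom produces a
door-class profile (Type-I time rate, space–time Type-I decay, continuity on the open backward slab, unit-viscosity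
Oseen–Duhamel identity, divergence-free slices) which is backward-singular at the apex and TILTING-FREE on a nonempty
open window of every slice. -/
theorem localPointZoomTiltingFreeWindow : ∀ (ν T : ℝ), 0 < ν → 0 < T → ∀ (u : ℝ → EuclideanSpace ℝ (Fin 3) → EuclideanSpace ℝ (Fin 3)) (p : ℝ → EuclideanSpace ℝ (Fin 3) → ℝ), Literature.Analysis.FluidPDE.IsClassicalNSSolutionOn (Set.Ico 0 T) ν 0 u p → Literature.Analysis.FluidPDE.IsLerayHopfOn T ν 0 (u 0) u → Literature.Analysis.FluidPDE.HasRapidSpatialDecay (u 0) → ∀ (x₀ : EuclideanSpace ℝ (Fin 3)) (ρ M : ℝ), 0 < ρ → (∀ t ∈ Set.Ico 0 T, T - ρ ^ 2 < t → ∀ x ∈ Metric.ball x₀ ρ, ‖u t x‖ * (‖x - x₀‖ + Real.sqrt (ν * (T - t))) ≤ M) → ∀ (U : Set (EuclideanSpace ℝ (Fin 3))), IsOpen U → U.Nonempty → Filter.Tendsto (fun t => ∫⁻ y in U, ENNReal.ofReal ‖Literature.Analysis.FluidPDE.cross (Literature.Analysis.FluidPDE.curlCLM (Real.sqrt (T -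 t) ^ 2 • fderiv ℝ (u t) (x₀ + Real.sqrt (T - t) • y))) ((Real.sqrt (T - t) ^ 2 • fderiv ℝ (u t) (x₀ + Real.sqrt (T - t) • y)) (Literature.Analysis.FluidPDE.curlCLM (Real.sqrt (T - t) ^ 2 • fderiv ℝ (u t) (x₀ + Real.sqrt (T - t) • y))))‖) (nhdsWithin T (Set.Iio T)) (nhds 0) → ¬ Literature.Analysis.FluidPDE.IsBackwardBoundedAt u T x₀ → ∃ (C D : ℝ) (v : ℝ → EuclideanSpace ℝ (Fin 3) → EuclideanSpace ℝ (Fin 3)), Literature.Analysis.FluidPDE.HasTypeITimeDecay C v ∧ Literature.Analysis.FluidPDE.HasTypeIDecay D v ∧ ContinuousOn (Function.uncurry v) (Set.Iio (0 : ℝ) ×ˢ Set.univ) ∧ (∀ s t : ℝ, s < t → t < 0 → ∀ x, v t x = Literature.Analysis.UnboundedOperators.heatExtension (v s) (t - s) x - Literature.Analysis.FluidPDE.oseenDuhamel 1 s v v t x) ∧ (∀ t < 0, Literature.Analysis.FluidPDE.VectorCalculus.IsDivFree (v t)) ∧ Literature.Analysis.FluidPDE.IsBackwardSingularPoint v 0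 ∧ (∀ s < 0, ∃ U : Set (EuclideanSpace ℝ (Fin 3)), IsOpen U ∧ U.Nonempty ∧ ∀ z ∈ U, Literature.Analysis.FluidPDE.cross (Literature.Analysis.FluidPDE.curlCLM (fderiv ℝ (v s) z)) ((fderiv ℝ (v s) z) (Literature.Analysis.FluidPDE.curlCLM (fderiv ℝ (v s) z))) = 0) := by
  intro ν T hν hT u p hcl hLH hdec x₀ ρ M hρ hM U hU hUne hfade hnot
  obtain ⟨C, v, lam, hlam, hlam0, ⟨hrate, hcont, hmild, hdiv⟩, hsing, hconv⟩ :=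
    localPointZoomVelGradSlices ν T hν hT u p hcl hLH hdec x₀ ρ M hρ (timeTypeI_of_spaceTimeTypeI hM) hnot
  have hdecay : HasTypeIDecay (M / ν) v :=
    hasTypeIDecay_of_zoom hν hT hρ hlam hlam0 hM fun s hs y => (hconv s hs y).1
  refine ⟨C, M / ν, v, hrate, hdecay, hcont, hmild, hdiv, hsing, fun s hs => ?_⟩
  have hns : 0 < -s := neg_pos.2 hs
  set σ : ℝ := Real.sqrt (-s) / Real.sqrt ν with hσ
  have hσpos : 0 < σ := div_pos (Real.sqrt_pos.2 hns) (Real.sqrt_pos.2 hν)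
  refine ⟨(fun z => σ⁻¹ • z) ⁻¹' U, hU.preimage (continuous_const_smul σ⁻¹), ?_, fun z hz => ?_⟩
  · obtain ⟨u₀, hu₀⟩ := hUne
    refine ⟨σ • u₀, ?_⟩
    show σ⁻¹ • (σ • u₀) ∈ U
    rwa [smul_smul, inv_mul_cancel₀ hσpos.ne', one_smul]
  · have hfade' : Tendsto (fun t => ∫⁻ y in U, ENNReal.ofReal
        |(fun (_ : EuclideanSpace ℝ (Fin 3)) (B : EuclideanSpace ℝ (Fin 3) →L[ℝ] EuclideanSpace ℝ (Fin 3)) =>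
            ‖cross (curlCLM B) (B (curlCLM B))‖)
          (Real.sqrt (T - t) • u t (x₀ + Real.sqrt (T - t) • y))
          (Real.sqrt (T - t) ^ 2 • fderiv ℝ (u t) (x₀ + Real.sqrt (T - t) • y))|) (𝓝[<] T) (𝓝 0) := by
      simpa only [abs_norm] using hfade
    exact norm_eq_zero.1 (windowFatou_firstOrder_of_zeroSetInvariant hν hT hcl hlam hlam0 hrate hcont hmild hconv
      (fun (_ : EuclideanSpace ℝ (Fin 3)) (B : EuclideanSpace ℝ (Fin 3) →L[ℝ] EuclideanSpace ℝ (Fin 3)) =>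
        ‖cross (curlCLM B) (B (curlCLM B))‖)
      continuous_tiltingNorm tiltingNorm_zeroSetInvariant hU hfade' hs hz)

/-! ### The door modulo K2 -/

/-- **`Target` of door S19 (text of nsreg-p1 `r18/Sketch19.lean`, verbatim) FROM the text of K2
`TiltingFreeProfileRigidity` alone**: if tilting-free Type-I ancient mild profiles (tilting-free on a nonempty open
window of every slice) are never backward-singular at the apex, then a classical Leray–Hopf flow from rapidly decaying
data, locally space–time Type I at `(x₀,T)`, whose scale-normalised vortex tilting `‖curl A × (A curl A)‖`,
`A = (T−t)∇u(t, x₀ + √(T−t)y)`, fades in `L¹` on one nonempty open similarity window, is backward bounded at `x₀`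
(generic space–time door `spaceTimeDoor_of_profileWindowRigidity`). -/
theorem target_of_tiltingFreeProfileRigidity
    (hK2 : ∀ (C D : ℝ) (v : ℝ → EuclideanSpace ℝ (Fin 3) → EuclideanSpace ℝ (Fin 3)), Literature.Analysis.FluidPDE.HasTypeITimeDecay C v → Literature.Analysis.FluidPDE.HasTypeIDecay D v → ContinuousOn (Function.uncurry v) (Set.Iio (0 : ℝ) ×ˢ Set.univ) → (∀ s t : ℝ, s < t → t < 0 → ∀ x, v t x = Literature.Analysis.UnboundedOperators.heatExtension (v s) (t - s) x - Literature.Analysis.FluidPDE.oseenDuhamel 1 s v v t x) → (∀ t < 0, Literature.Analysis.FluidPDE.VectorCalculus.IsDivFree (v t)) → (∀ s < 0, ∃ U : Set (EuclideanSpace ℝ (Fin 3)), IsOpen U ∧ U.Nonempty ∧ ∀ z ∈ U, Literature.Analysis.FluidPDE.cross (Literature.Analysis.FluidPDE.curlCLM (fderiv ℝ (v s) z)) ((fderiv ℝ (v s) z) (Literature.Analysis.FluidPDE.curlCLM (fderiv ℝ (v s) z))) = 0) → ¬ Literature.Analysis.FluidPDE.IsBackwardSingularPoint v 0) :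
    ∀ (ν T : ℝ), 0 < ν → 0 < T → ∀ (u : ℝ → EuclideanSpace ℝ (Fin 3) → EuclideanSpace ℝ (Fin 3)) (p : ℝ → EuclideanSpace ℝ (Fin 3) → ℝ), Literature.Analysis.FluidPDE.IsClassicalNSSolutionOn (Set.Ico 0 T) ν 0 u p → Literature.Analysis.FluidPDE.IsLerayHopfOn T ν 0 (u 0) u → Literature.Analysis.FluidPDE.HasRapidSpatialDecay (u 0) → ∀ (x₀ : EuclideanSpace ℝ (Fin 3)) (ρ M : ℝ), 0 < ρ → (∀ t ∈ Set.Ico 0 T, T - ρ ^ 2 < t → ∀ x ∈ Metric.ball x₀ ρ, ‖u t x‖ * (‖x - x₀‖ + Real.sqrt (ν * (T - t))) ≤ M) → ∀ (U : Set (EuclideanSpace ℝ (Fin 3))), IsOpen U → U.Nonempty → Filter.Tendsto (fun t => ∫⁻ y in U, ENNReal.ofReal ‖Literature.Analysis.FluidPDE.cross (Literature.Analysis.FluidPDE.curlCLM (Real.sqrt (T - t) ^ 2 • fderiv ℝ (u t) (x₀ + Real.sqrt (T - t) • y))) ((Real.sqrt (T - t) ^ 2 • fderiv ℝ (u t) (x₀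 + Real.sqrt (T - t) • y)) (Literature.Analysis.FluidPDE.curlCLM (Real.sqrt (T - t) ^ 2 • fderiv ℝ (u t) (x₀ + Real.sqrt (T - t) • y))))‖) (nhdsWithin T (Set.Iio T)) (nhds 0) → Literature.Analysis.FluidPDE.IsBackwardBoundedAt u T x₀ := by
  intro ν T hν hT u p hcl hLH hdec x₀ ρ M hρ hM U hU hUne hfade
  have hfade' : Tendsto (fun t => ∫⁻ y in U, ENNReal.ofReal
      |(fun A : EuclideanSpace ℝ (Fin 3) →L[ℝ] EuclideanSpace ℝ (Fin 3) => ‖cross (curlCLM A) (A (curlCLM A))‖)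
        (Real.sqrt (T - t) ^ 2 • fderiv ℝ (u t) (x₀ + Real.sqrt (T - t) • y))|) (𝓝[<] T) (𝓝 0) := by
    simpa only [abs_norm] using hfade
  refine spaceTimeDoor_of_profileWindowRigidity
    (fun A : EuclideanSpace ℝ (Fin 3) →L[ℝ] EuclideanSpace ℝ (Fin 3) => ‖cross (curlCLM A) (A (curlCLM A))‖)
    continuous_tiltingNorm tiltingNorm_zeroSetInvariant (fun C D v hrate hdecay hcont hmild hdiv hwin => ?_)
    ν T hν hT u p hcl hLH hdec x₀ ρ M hρ hM U hU hUne hfade'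
  refine hK2 C D v hrate hdecay hcont hmild hdiv fun s hs => ?_
  obtain ⟨W, hW, hWne, h⟩ := hwin s hs
  exact ⟨W, hW, hWne, fun z hz => norm_eq_zero.1 (h z hz)⟩

end Summit.NavierStokesRegularity.NavierStokesRegularity.Theorems.LocalTiltingFreeDoorTarget

end
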